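import Summits.BirchSwinnertonDyer.BirchSwinnertonDyer.Theses.InertBadSignedBranches
import Summits.BirchSwinnertonDyer.Rank1Residual.Additive.CyclotomicTowerSignedSelmerDual
import Literature.NumberTheory.EllipticCurves.BurungaleTian2026.EtaSignedMainConjectureMuCriterionProofs
import HarnessLib

/-!
# Route `InertBadSignedBranches` (rung K8), item 19865 `PlusMCEtaKMuPart`: the `μ`-part is
# SIGN-SYMMETRIC — the even `μ`-part (item 19865) ⟺ the odd `μ`-part, granted the published inputs
# 19867 `PublishedInputsEtaUpToP` only (helper `--supports stmt-BirchSwinnertonDyer-19865`;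
# READY-TO-FILE by a prover hand; drafted and lean-checked by the typer seat bsd-cm-k8i-ty g8)

HONEST FRAMING (cell bsd-cm): BSD is NOT proved by any of this; nothing here closes an item or a
cell; no label moves; no definition, no new fact, no `sorry`. The residual crux 19865 (`μ(X⁺(V/K_∞)^η)
= μ(Λ/(L_p⁺(V, η, X)))`, open in print: [BT26] Rem. 2.7 / Rem. 2.2) stays OPEN. This file records,
on the route's OWN objects (`Additive.EtaSignedSelmerDualData`, `Additive.IsQuadraticBranch{Plus,
Minus}LFunction`), the kernel consequences of the Literature file
`BurungaleTian2026/EtaSignedMainConjectureMuCriterionProofs.lean` §3 (p481279, seat k8i-ty g8):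
granted ONLY `h26` ([BT26] Thm. 2.6 read at `η`, composed citation) and `h22` ([Kob03] Thm. 2.2 at
`η`) — i.e. item 19867 `PublishedInputsEtaUpToP`, NOT the Thm. 7.4 fact of 19584 —
(1) `muInvariant_even_add_eq_odd_add`: for every plus pair `(Lp, D⁺)` and every minus pair
`(Lm = X·L', D⁻)` of a CM `V` in the frame of 19501/19865, `μ(X(D⁺)) + μ(Λ/(L')) = μ(X(D⁻)) +
μ(Λ/(Lp))` — the `μ`-defects of Kobayashi's even and odd `η`-main conjectures coincide (both are
`μ(X⁰(V/K_∞)^η) − μ(𝐇¹(T)^η/Z(T)^η)`, the `μ`-part of Kato's main conjecture at `η`);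
(2) `plusMCEtaKMuPart_iff_oddEtaMuPart`: item 19865 ⟺ its odd-side twin («`μ(X⁻(V/K_∞)^η) =
μ(Λ/((1/X)L_p⁻(V, η, X)))`», same frame), the data's non-emptiness DISCHARGED here by
`Additive.nonempty_etaSignedSelmerDualData_cyclotomic` — so the route's odd-side readings carry no
second `μ`-residual;
(3) `oddEtaMC_of_plusMCEtaK`: `PublishedInputsEtaUpToP → PlusMCEtaK →` Kobayashi's ODD main
conjecture at `η` for CM `V` (`∀ (Lm = X·L', D⁻)`, `Char X(D⁻) = (L')`) WITHOUT the named fact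
`Kobayashi2003.thm74_etaEvenMC_iff_etaOddMC` (19584): on CM curves the even → odd passage is carried
by [BT26]'s package. (4) `thm74EtaOnCM_of_publishedInputs`: the exact shape of the named fact
`Kobayashi2003.thm74_etaEvenMC_iff_etaOddMC` (item 19584) ON CM CURVES, from 19867 alone.
Whether to use this to lighten the K8-inert cone is the planner's call.
Transport: the field-for-field (`rfl`) copy `Additive.EtaSignedSelmerDualData →
Kobayashi2003.EtaSignedSelmerDualData` (the anonymous-constructor term of
`PrintReadingsOfLiterature.toLiterature`, inlined) and `Iff.rfl` between the Summits and Literature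
pinning predicates of `L_p^±(V, η, X)`.

References: [BurungaleTian2026] Thm. 2.6, Rem. 2.7 (p. 5); [Kobayashi2003] §4 (p. 8), Thm. 7.4 and
its proof (p. 13), (3.7) (p. 7), Thm. 2.2 (p. 5); [Washington1997] §13.2.
-/

set_option linter.dupNamespace false

noncomputable section

open scoped Classical

open CongruenceSubgroup WeierstrassCurve Field Literature.NumberTheory.EllipticCurves
  Literature.NumberTheory.EllipticCurves.ModularForms Literature.NumberTheory.GaloisRepresentations
  ZpExtension Summit.BirchSwinnertonDyer.Rank1Residual
  Summit.BirchSwinnertonDyer.BirchSwinnertonDyer.Theses.InertBadSignedBranches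

namespace Summit.BirchSwinnertonDyer.BirchSwinnertonDyer.Theorems.PlusMCEtaKMuPartSignSymmetry

/-- **Sign-independence of the `μ`-defect on the route's objects (pointwise; kernel).** For a CM
`V` in the frame of items 19501/19865, granted `h26` ∧ `h22` (= 19867 `PublishedInputsEtaUpToP`):
`μ(X(D⁺)) + μ(Λ/(L')) = μ(X(D⁻)) + μ(Λ/(Lp))` for every plus pair `(Lp, D⁺)` and minus pair
`(Lm = X·L', D⁻)`. Transport of
`BurungaleTian2026.muInvariant_even_add_eq_odd_add_of_cm` (p481279).
[cite: BurungaleTian2026, Thm. 2.6 and Rem. 2.7 (p. 5)] [cite: Kobayashi2003, proof of Thm. 7.4 (p. 13), §4 (p. 8)]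
[cite: Washington1997, §13.2] -/
theorem muInvariant_even_add_eq_odd_add
    (h26 : BurungaleTian2026.thm26_etaKatoSequences_charIdeal_upToP_of_cm)
    (h22 : Kobayashi2003.thm22_etaSignedSelmerDual_finite_torsion)
    (p : ℕ) [Fact p.Prime] (hp : p ≠ 2) (K₀ : Type) [Field K₀] [NumberField K₀]
    [IsCyclotomicExtension {p} ℚ K₀] [(galRange (K := ℚ) K₀).Normal]
    (η : absoluteGaloisGroup ℚ →* ℤˣ) (hη : ∀ σ ∈ galRange (K := ℚ) K₀, η σ = 1) (hη1 : η ≠ 1)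
    (V : WeierstrassCurve ℚ) [V.IsElliptic] [V.IsGloballyMinimal] {N : ℕ} [NeZero N]
    {f : CuspForm (Gamma0 N) 2} (hCM : V.HasCM) (hgood : V.HasGoodReductionAtPrime p)
    (hap : V.frobeniusTrace p = 0) (hf : IsNewformOf V f) (ϖ : ℚ)
    (hϖ : if Even (p / 2) then (ϖ : ℝ) * V.realPeriodRat = plusPeriod f
      else (ϖ : ℝ) * V.imaginaryPeriodRat = minusPeriod f)
    (κ : ZpExtension ℚ p) (γ : absoluteGaloisGroup ℚ) (hκ : κ.IsCyclotomic) (hγ : κ.IsTopGenerator γ)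
    (hγK : γ ∈ galRange (K := ℚ) K₀) (hvar : IsCyclotomicVariable p γ)
    (Lp : IwasawaAlgebra p) (hLp : Additive.IsQuadraticBranchPlusLFunction f p ϖ Lp)
    (Dp : Additive.EtaSignedSelmerDualData V κ K₀ ℚ_[p] η γ 1)
    (Lm : IwasawaAlgebra p) (hLm : Additive.IsQuadraticBranchMinusLFunction f p ϖ Lm)
    (L' : IwasawaAlgebra p) (hL' : Lm = PowerSeries.X * L')
    (Dm : Additive.EtaSignedSelmerDualData V κ K₀ ℚ_[p] η γ (-1)) :
    muInvariant p Dp.X + muInvariant p (IwasawaAlgebra p ⧸ Ideal.span {L'}) =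
      muInvariant p Dm.X + muInvariant p (IwasawaAlgebra p ⧸ Ideal.span {Lp}) := by
  -- the Literature copies of the pinning predicates ARE the Summits originals (`Iff.rfl`)
  have hLp' : Kobayashi2003.IsQuadraticBranchPlusLFunction f p ϖ Lp := hLp
  have hLm' : Kobayashi2003.IsQuadraticBranchMinusLFunction f p ϖ Lm := hLm
  -- field-for-field transports of the two dual data (same modules `D.X`)
  let Dp' : Kobayashi2003.EtaSignedSelmerDualData V κ K₀ ℚ_[p] η γ 1 :=
    ⟨Dp.X, Dp.conj_mem, Dp.toDual, Dp.bijective, Dp.toDual_T_smul, Dp.toDual_C_smul⟩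
  let Dm' : Kobayashi2003.EtaSignedSelmerDualData V κ K₀ ℚ_[p] η γ (-1) :=
    ⟨Dm.X, Dm.conj_mem, Dm.toDual, Dm.bijective, Dm.toDual_T_smul, Dm.toDual_C_smul⟩
  exact BurungaleTian2026.muInvariant_even_add_eq_odd_add_of_cm h26 h22 K₀ η hη hη1 V hp hCM hgood
    hap hf ϖ hϖ κ γ hκ hγ hγK hvar Lp hLp' Dp' Lm hLm' L' hL' Dm'

/-- **Item 19865 `PlusMCEtaKMuPart` ⟺ its odd-side twin (kernel), granted 19867
`PublishedInputsEtaUpToP` only.** The odd twin: same frame, for every `Lm` with the interpolation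
property of `L_p⁻(V, η, X)`, every `L'` with `Lm = X·L'` ((3.7)) and every minus datum `D⁻`,
`μ(X(D⁻)) = μ(Λ/(L'))` («`Char(X⁻(E/K_∞)^η) = ((1/X)L⁻_p(E, η, X))`» read through `μ`, [Kob03] §4
p. 8). Non-emptiness of the data is DISCHARGED (`Additive.nonempty_etaSignedSelmerDualData_cyclotomic`);
plus / minus functions exist by the package `h26` itself. 19865 stays open; nothing is booked.
[cite: BurungaleTian2026, Thm. 2.6 and Rem. 2.7 (p. 5)] [cite: Kobayashi2003, §4 (p. 8), proof of Thm. 7.4 (p. 13), (3.7) (p. 7)]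
[cite: Washington1997, §13.2] -/
theorem plusMCEtaKMuPart_iff_oddEtaMuPart (hF : PublishedInputsEtaUpToP) :
    PlusMCEtaKMuPart ↔
      ∀ (p : ℕ) [Fact p.Prime], p ≠ 2 → ∀ (K₀ : Type) [Field K₀] [NumberField K₀]
        [IsCyclotomicExtension {p} ℚ K₀] [(galRange (K := ℚ) K₀).Normal]
        (η : absoluteGaloisGroup ℚ →* ℤˣ), (∀ σ ∈ galRange (K := ℚ) K₀, η σ = 1) → η ≠ 1 →
      ∀ (V : WeierstrassCurve ℚ) [V.IsElliptic] [V.IsGloballyMinimal] {N : ℕ} [NeZero N]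
        {f : CuspForm (Gamma0 N) 2}, V.HasCM → V.HasGoodReductionAtPrime p →
        V.frobeniusTrace p = 0 → IsNewformOf V f →
      ∀ (ϖ : ℚ), (if Even (p / 2) then (ϖ : ℝ) * V.realPeriodRat = plusPeriod f
          else (ϖ : ℝ) * V.imaginaryPeriodRat = minusPeriod f) →
      ∀ (κ : ZpExtension ℚ p) (γ : absoluteGaloisGroup ℚ), κ.IsCyclotomic → κ.IsTopGenerator γ →
        γ ∈ galRange (K := ℚ) K₀ → IsCyclotomicVariable p γ →
      ∀ (Lm : IwasawaAlgebra p), Additive.IsQuadraticBranchMinusLFunction f p ϖ Lm →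
      ∀ (L' : IwasawaAlgebra p), Lm = PowerSeries.X * L' →
      ∀ (D : Additive.EtaSignedSelmerDualData V κ K₀ ℚ_[p] η γ (-1)),
        muInvariant p D.X = muInvariant p (IwasawaAlgebra p ⧸ Ideal.span {L'}) := by
  obtain ⟨h26, h22⟩ := hF
  constructor
  · intro hμ p _ hp K₀ _ _ _ _ η hη hη1 V _ _ N _ f hCM hgood hap hf ϖ hϖ κ γ hκ hγ hγK hvar Lm hLm
      L' hL' Dm
    obtain ⟨Dp⟩ := Additive.nonempty_etaSignedSelmerDualData_cyclotomic V κ K₀ ℚ_[p] η (1 : ℤˣ) hγ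
      hγK
    -- a plus function exists by the package
    obtain ⟨A, B, _, _, _, _, -, -, -, ⟨Lp, hLp, -⟩, -⟩ :=
      h26 p K₀ η hη hη1 V hp hCM hgood hap hf ϖ hϖ κ γ hκ hγ hγK hvar
    have hLpA : Additive.IsQuadraticBranchPlusLFunction f p ϖ Lp := hLp
    have e := muInvariant_even_add_eq_odd_add h26 h22 p hp K₀ η hη hη1 V hCM hgood hap hf ϖ hϖ κ γ
      hκ hγ hγK hvar Lp hLpA Dp Lm hLm L' hL' Dm
    have := hμ p hp K₀ η hη hη1 V hCM hgood hap hf ϖ hϖ κ γ hκ hγ hγK hvar Lp hLpA Dp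
    omega
  · intro hμ p _ hp K₀ _ _ _ _ η hη hη1 V _ _ N _ f hCM hgood hap hf ϖ hϖ κ γ hκ hγ hγK hvar Lp hLp Dp
    obtain ⟨Dm⟩ := Additive.nonempty_etaSignedSelmerDualData_cyclotomic V κ K₀ ℚ_[p] η (-1 : ℤˣ)
      hγ hγK
    -- a minus function exists by the package, and is divisible by `X` ((3.7))
    obtain ⟨A, B, _, _, _, _, -, -, -, -, ⟨Lm, hLm, -⟩⟩ :=
      h26 p K₀ η hη hη1 V hp hCM hgood hap hf ϖ hϖ κ γ hκ hγ hγK hvar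
    obtain ⟨L', hL'⟩ := hLm.exists_eq_X_mul
    have hLmA : Additive.IsQuadraticBranchMinusLFunction f p ϖ Lm := hLm
    have e := muInvariant_even_add_eq_odd_add h26 h22 p hp K₀ η hη hη1 V hCM hgood hap hf ϖ hϖ κ γ
      hκ hγ hγK hvar Lp hLp Dp Lm hLmA L' hL' Dm
    have := hμ p hp K₀ η hη hη1 V hCM hgood hap hf ϖ hϖ κ γ hκ hγ hγK hvar Lm hLmA L' hL' Dm
    omega

/-- **Kobayashi's ODD main conjecture at `η` for the route's CM twins, from `PlusMCEtaK` and the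
published inputs 19867 — WITHOUT the Thm. 7.4 fact (19584).** For every CM `V` in the frame of
19501, every `Lm` with the interpolation property of `L_p⁻(V, η, X)`, every `L'` with `Lm = X·L'`
and every minus datum `D⁻`: `Char X(D⁻) = (L')`. Pointwise even ⟺ odd is
`BurungaleTian2026.evenEtaCharIdeal_eq_iff_oddEtaCharIdeal_eq_of_cm` (p481279); a plus datum to feed
`PlusMCEtaK` exists by `Additive.nonempty_etaSignedSelmerDualData_cyclotomic`, a plus function by the
package. Offered to the planner: on CM curves the even → odd passage of the K8-inert cone needs only
19867. Closes nothing. [cite: Kobayashi2003, Thm. 7.4 (p. 13), §4 (p. 8)]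
[cite: BurungaleTian2026, Thm. 2.6 (p. 5)] -/
theorem oddEtaMC_of_plusMCEtaK (hF : PublishedInputsEtaUpToP) (hK : PlusMCEtaK)
    (p : ℕ) [Fact p.Prime] (hp : p ≠ 2) (K₀ : Type) [Field K₀] [NumberField K₀]
    [IsCyclotomicExtension {p} ℚ K₀] [(galRange (K := ℚ) K₀).Normal]
    (η : absoluteGaloisGroup ℚ →* ℤˣ) (hη : ∀ σ ∈ galRange (K := ℚ) K₀, η σ = 1) (hη1 : η ≠ 1)
    (V : WeierstrassCurve ℚ) [V.IsElliptic] [V.IsGloballyMinimal] {N : ℕ} [NeZero N]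
    {f : CuspForm (Gamma0 N) 2} (hCM : V.HasCM) (hgood : V.HasGoodReductionAtPrime p)
    (hap : V.frobeniusTrace p = 0) (hf : IsNewformOf V f) (ϖ : ℚ)
    (hϖ : if Even (p / 2) then (ϖ : ℝ) * V.realPeriodRat = plusPeriod f
      else (ϖ : ℝ) * V.imaginaryPeriodRat = minusPeriod f)
    (κ : ZpExtension ℚ p) (γ : absoluteGaloisGroup ℚ) (hκ : κ.IsCyclotomic) (hγ : κ.IsTopGenerator γ)
    (hγK : γ ∈ galRange (K := ℚ) K₀) (hvar : IsCyclotomicVariable p γ)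
    (Lm : IwasawaAlgebra p) (hLm : Additive.IsQuadraticBranchMinusLFunction f p ϖ Lm)
    (L' : IwasawaAlgebra p) (hL' : Lm = PowerSeries.X * L')
    (Dm : Additive.EtaSignedSelmerDualData V κ K₀ ℚ_[p] η γ (-1)) :
    Dm.charIdeal = Ideal.span {L'} := by
  obtain ⟨h26, h22⟩ := hF
  obtain ⟨Dp⟩ := Additive.nonempty_etaSignedSelmerDualData_cyclotomic V κ K₀ ℚ_[p] η (1 : ℤˣ) hγ
    hγK
  obtain ⟨A, B, _, _, _, _, -, -, -, ⟨Lp, hLp, -⟩, -⟩ :=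
    h26 p K₀ η hη hη1 V hp hCM hgood hap hf ϖ hϖ κ γ hκ hγ hγK hvar
  have hLpA : Additive.IsQuadraticBranchPlusLFunction f p ϖ Lp := hLp
  have hLm' : Kobayashi2003.IsQuadraticBranchMinusLFunction f p ϖ Lm := hLm
  have heven : Dp.charIdeal = Ideal.span {Lp} :=
    hK p hp K₀ η hη hη1 V hCM hgood hap hf ϖ hϖ κ γ hκ hγ hγK hvar Lp hLpA Dp
  let Dp' : Kobayashi2003.EtaSignedSelmerDualData V κ K₀ ℚ_[p] η γ 1 :=
    ⟨Dp.X, Dp.conj_mem, Dp.toDual, Dp.bijective, Dp.toDual_T_smul, Dp.toDual_C_smul⟩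
  let Dm' : Kobayashi2003.EtaSignedSelmerDualData V κ K₀ ℚ_[p] η γ (-1) :=
    ⟨Dm.X, Dm.conj_mem, Dm.toDual, Dm.bijective, Dm.toDual_T_smul, Dm.toDual_C_smul⟩
  have hDp' : Dp'.charIdeal = Dp.charIdeal := rfl
  have hDm' : Dm'.charIdeal = Dm.charIdeal := rfl
  have h := BurungaleTian2026.evenEtaCharIdeal_eq_iff_oddEtaCharIdeal_eq_of_cm h26 h22 K₀ η hη hη1 V
    hp hCM hgood hap hf ϖ hϖ κ γ hκ hγ hγK hvar Lp hLp Dp' Lm hLm' L' hL' Dm'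
  rw [hDp', hDm'] at h
  exact h.mp heven

/-- **[Kob03] Thm. 7.4 (ii) ⟺ (iii) at `η` ON CM CURVES, in the exact shape of the named fact
`Kobayashi2003.thm74_etaEvenMC_iff_etaOddMC` (item 19584) with `V.HasCM` added, from the published
inputs 19867 alone** (route's objects; non-emptiness of the data discharged by
`Additive.nonempty_etaSignedSelmerDualData_cyclotomic`; transport of
`BurungaleTian2026.etaEvenMC_iff_etaOddMC_of_cm`, p481279). For a re-thread of the K8-inert cone's
`h74` use on CM twins, at the planner's discretion. Closes nothing.
[cite: Kobayashi2003, Thm. 7.4 (p. 13), §4 (p. 8)] [cite: BurungaleTian2026, Thm. 2.6 (p. 5)] -/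
theorem thm74EtaOnCM_of_publishedInputs (hF : PublishedInputsEtaUpToP)
    (p : ℕ) [Fact p.Prime] (K₀ : Type) [Field K₀] [NumberField K₀]
    [IsCyclotomicExtension {p} ℚ K₀] [(galRange (K := ℚ) K₀).Normal]
    (η : absoluteGaloisGroup ℚ →* ℤˣ) (hη : ∀ σ ∈ galRange (K := ℚ) K₀, η σ = 1) (hη1 : η ≠ 1)
    (V : WeierstrassCurve ℚ) [V.IsElliptic] [V.IsGloballyMinimal] {N : ℕ} [NeZero N]
    {f : CuspForm (Gamma0 N) 2} (hp : p ≠ 2) (hCM : V.HasCM) (hgood : V.HasGoodReductionAtPrime p)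
    (hap : V.frobeniusTrace p = 0) (hf : IsNewformOf V f) (ϖ : ℚ)
    (hϖ : if Even (p / 2) then (ϖ : ℝ) * V.realPeriodRat = plusPeriod f
      else (ϖ : ℝ) * V.imaginaryPeriodRat = minusPeriod f)
    (κ : ZpExtension ℚ p) (γ : absoluteGaloisGroup ℚ) (hκ : κ.IsCyclotomic) (hγ : κ.IsTopGenerator γ)
    (hγK : γ ∈ galRange (K := ℚ) K₀) (hvar : IsCyclotomicVariable p γ) :
    (∀ (Lp : IwasawaAlgebra p), Additive.IsQuadraticBranchPlusLFunction f p ϖ Lp →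
        ∀ D : Additive.EtaSignedSelmerDualData V κ K₀ ℚ_[p] η γ 1, D.charIdeal = Ideal.span {Lp}) ↔
      (∀ (Lm : IwasawaAlgebra p), Additive.IsQuadraticBranchMinusLFunction f p ϖ Lm →
        ∀ (D : Additive.EtaSignedSelmerDualData V κ K₀ ℚ_[p] η γ (-1)) (L' : IwasawaAlgebra p),
          Lm = PowerSeries.X * L' → D.charIdeal = Ideal.span {L'}) := by
  obtain ⟨h26, h22⟩ := hF
  obtain ⟨Dp₀⟩ := Additive.nonempty_etaSignedSelmerDualData_cyclotomic V κ K₀ ℚ_[p] η (1 : ℤˣ) hγ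
    hγK
  obtain ⟨Dm₀⟩ := Additive.nonempty_etaSignedSelmerDualData_cyclotomic V κ K₀ ℚ_[p] η (-1 : ℤˣ)
    hγ hγK
  -- Literature copies of the two witnesses (field-for-field)
  let Dp₀' : Kobayashi2003.EtaSignedSelmerDualData V κ K₀ ℚ_[p] η γ 1 :=
    ⟨Dp₀.X, Dp₀.conj_mem, Dp₀.toDual, Dp₀.bijective, Dp₀.toDual_T_smul, Dp₀.toDual_C_smul⟩
  let Dm₀' : Kobayashi2003.EtaSignedSelmerDualData V κ K₀ ℚ_[p] η γ (-1) :=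
    ⟨Dm₀.X, Dm₀.conj_mem, Dm₀.toDual, Dm₀.bijective, Dm₀.toDual_T_smul, Dm₀.toDual_C_smul⟩
  have hlit := BurungaleTian2026.etaEvenMC_iff_etaOddMC_of_cm h26 h22 K₀ η hη hη1 V hp hCM hgood hap
    hf ϖ hϖ κ γ hκ hγ hγK hvar ⟨Dp₀'⟩ ⟨Dm₀'⟩
  -- move between the Summits data (arbitrary `D`) and their Literature copies, both directions
  constructor
  · intro heven Lm hLm Dm L' hL'
    have hLm' : Kobayashi2003.IsQuadraticBranchMinusLFunction f p ϖ Lm := hLm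
    let Dm' : Kobayashi2003.EtaSignedSelmerDualData V κ K₀ ℚ_[p] η γ (-1) :=
      ⟨Dm.X, Dm.conj_mem, Dm.toDual, Dm.bijective, Dm.toDual_T_smul, Dm.toDual_C_smul⟩
    have hDm' : Dm'.charIdeal = Dm.charIdeal := rfl
    have heven' : ∀ (Lp : IwasawaAlgebra p), Kobayashi2003.IsQuadraticBranchPlusLFunction f p ϖ Lp →
        ∀ D : Kobayashi2003.EtaSignedSelmerDualData V κ K₀ ℚ_[p] η γ 1,
          D.charIdeal = Ideal.span {Lp} := by
      intro Lp hLp D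
      let D₀ : Additive.EtaSignedSelmerDualData V κ K₀ ℚ_[p] η γ 1 :=
        ⟨D.X, D.conj_mem, D.toDual, D.bijective, D.toDual_T_smul, D.toDual_C_smul⟩
      have hD₀ : D₀.charIdeal = D.charIdeal := rfl
      rw [← hD₀]
      exact heven Lp hLp D₀
    rw [← hDm']
    exact (hlit.mp heven') Lm hLm' L' hL' Dm'
  · intro hodd Lp hLp Dp
    have hLp' : Kobayashi2003.IsQuadraticBranchPlusLFunction f p ϖ Lp := hLp
    let Dp' : Kobayashi2003.EtaSignedSelmerDualData V κ K₀ ℚ_[p] η γ 1 :=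
      ⟨Dp.X, Dp.conj_mem, Dp.toDual, Dp.bijective, Dp.toDual_T_smul, Dp.toDual_C_smul⟩
    have hDp' : Dp'.charIdeal = Dp.charIdeal := rfl
    have hodd' : ∀ (Lm : IwasawaAlgebra p), Kobayashi2003.IsQuadraticBranchMinusLFunction f p ϖ Lm →
        ∀ (L' : IwasawaAlgebra p), Lm = PowerSeries.X * L' →
        ∀ D : Kobayashi2003.EtaSignedSelmerDualData V κ K₀ ℚ_[p] η γ (-1),
          D.charIdeal = Ideal.span {L'} := by
      intro Lm hLm L' hL' D
      let D₀ : Additive.EtaSignedSelmerDualData V κ K₀ ℚ_[p] η γ (-1) :=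
        ⟨D.X, D.conj_mem, D.toDual, D.bijective, D.toDual_T_smul, D.toDual_C_smul⟩
      have hD₀ : D₀.charIdeal = D.charIdeal := rfl
      rw [← hD₀]
      exact hodd Lm hLm D₀ L' hL'
    rw [← hDp']
    exact (hlit.mpr hodd') Lp hLp' Dp'

end Summit.BirchSwinnertonDyer.BirchSwinnertonDyer.Theorems.PlusMCEtaKMuPartSignSymmetry

end
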